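import Summits.Ventures.LatticeQCDFlow.Scaling.IdealStarSeparation
import Summits.Ventures.LatticeQCDFlow.Scaling.FlowStarMixingCeiling
import Summits.Ventures.LatticeQCDFlow.Scaling.ProductRefreshCeiling

/-!
HONEST FRAMING: exact (Metropolis-corrected) sampling algorithms for lattice gauge theory; figures
of merit are autocorrelation/cost numbers at stated couplings and volumes; no continuum-physics
claim.

# FreshnessSeparation — THE SEPARATION CEILINGS OF THE TWO OTHER FRESHNESS COUPLINGS: THE PERFECTLY TRANSPORTED HUB
# (`s(n) ≤ (K+1)·(1 − t(1−t)c/(2m))ⁿ/t`, SEPARATION BEING INVARIANT UNDER THE LEVEL RELABELLING) AND THE EXACT-REFRESH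
# PRODUCT CHAIN (`s(n) ≤ Σ_k (1 − w_k)ⁿ`) (lean-2 GEN-24, ours)

Venture-side (OURS).  Cell `lqcd-flow` (pub-lqcd), unit `pub-lqcd-lean-2-g24`, 2026-08-27.  Chapter L (the coupon-collector
law from a cold start), file 20.  `Scaling/IdealStarSeparation` bounded Levin–Peres–Wilmer's separation distance of the
idealised star; here the same for the map-assisted hub with perfect transports (`Scaling/FlowStarMixingCeiling`: it
is the idealised star in level coordinates — and `s(t)` is invariant under relabelling the state space, proved here)
and for the exact-refresh product chain (`Scaling/ProductRefreshCeiling`, whose minorisation is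
`δ_x Pⁿ ≥ (δ_{univ}Rⁿ)(∅)·π̃`).

## What is proved

* §1 **`kernelAt_relabel`**, **`sepDistFrom_relabel`**, **`sepDist_relabel`** — `Pᵗ`, `s_x(t)` and `s(t)` under a
  relabelling `e` of the state space (`Pᵗ_{P∘(e×e)}(x,y) = Pᵗ(e x, e y)`, `s_{P∘(e×e),π∘e}(t) = s_{P,π}(t)`).
* §2 **`flowStar_sepDist_le`** — perfect transports `μ_{k+1}∘φ_k = μ_0`, exact hot sampler:
  `s(n) ≤ (K+1)·(1 − t(1−t)c/(2m))ⁿ/t`.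
* §3 **`refresh_kernelAt_ge`** (`Pⁿ(x,z) ≥ (1 − Σ_k(1−w_k)ⁿ)·π̃(z)`), **`refresh_sepDist_le`** —
  `s(n) ≤ Σ_k (1 − w_k)ⁿ` for the exact-refresh product chain.

Reading (no numerics implied): all three freshness couplings of chapter L give whole-space Doeblin conditions at the
coupon-collector time, not merely total-variation proximity.  NOT CLAIMED: anything beyond the three idealised models.
Literature grade (cell rule): OWN COMPOSITION; nothing cited as a fact; no new bib keys.
-/

noncomputable section

open Finset Function
open Literature.Probability.MarkovChains

namespace Summit.Ventures.LatticeQCDFlow.Scaling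

/-! ## §1 Separation is invariant under relabelling -/

section Relabel
variable {X : Type*} [Fintype X] [DecidableEq X]

/-- `Pᵗ` of the relabelled chain: `kernelAt (P∘(e×e)) t x y = kernelAt P t (e x) (e y)`. [ours] -/
theorem kernelAt_relabel (e : X ≃ X) (P : X → X → ℝ) (t : ℕ) (x y : X) :
    kernelAt (fun a b => P (e a) (e b)) t x y = kernelAt P t (e x) (e y) := by
  unfold kernelAt
  rw [← single_relabel e x, lawAt_relabel e P (Pi.single (e x) 1) t]

/-- `s_x(t)` of the relabelled chain is `s_{e x}(t)`. [ours] -/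
theorem sepDistFrom_relabel (e : X ≃ X) (P : X → X → ℝ) (π : X → ℝ) (x : X) (t : ℕ) :
    sepDistFrom (fun a b => P (e a) (e b)) (fun a => π (e a)) x t = sepDistFrom P π (e x) t := by
  unfold sepDistFrom
  simp_rw [kernelAt_relabel]
  exact Equiv.iSup_comp (g := fun y => 1 - kernelAt P t (e x) y / π y) e

/-- **`s(t)` is invariant under relabelling.** [ours] -/
theorem sepDist_relabel (e : X ≃ X) (P : X → X → ℝ) (π : X → ℝ) (t : ℕ) :
    sepDist (fun a b => P (e a) (e b)) (fun a => π (e a)) t = sepDist P π t := by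
  unfold sepDist
  simp_rw [sepDistFrom_relabel]
  exact Equiv.iSup_comp (g := fun x => sepDistFrom P π x t) e

end Relabel

variable {S : Type*} [Fintype S] [DecidableEq S]

/-! ## §2 The perfectly transported hub -/

section Flow
variable {K m : ℕ} {μ : Fin (K + 1) → S → ℝ} {M : Fin (K + 1) → S → S → ℝ} {t : ℝ}
variable (κ : Fin m → Fin K) (φ : Fin K → Equiv.Perm S)

/-- **THE SEPARATION CEILING WITH PERFECT TRANSPORTS: `s(n) ≤ (K+1)·(1 − t(1−t)c/(2m))ⁿ/t`.** [ours] -/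
theorem flowStar_sepDist_le (hm : 1 ≤ m) (ht0 : 0 < t) (ht1 : t < 1) (hμ : ∀ k x, 0 < μ k x)
    (hμ01 : ∑ v, μ 0 v = 1) (hM : ∀ k, IsRowStochastic (M k)) (hM0 : ∀ u v, M 0 u v = μ 0 v)
    (hperf : ∀ (k : Fin K) (u : S), μ k.succ (φ k u) = μ 0 u) {c : ℕ} (hc1 : 1 ≤ c)
    (hc : ∀ p : Fin K, c ≤ (univ.filter (fun r : Fin m => κ r = p)).card) (hcm : c ≤ m) (n : ℕ) :
    sepDist (fun y z : Fin (K + 1) → S =>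
        t * ptGraphSwap μ (fun r : Fin m => ((0 : Fin (K + 1)), (κ r).succ)) (fun r => φ (κ r)) y z
          + (1 - t) * prodKernel (fun k : Fin (K + 1) => if k = 0 then (1 : ℝ) else 0) M y z) (tensorFun μ) n
      ≤ ((K : ℝ) + 1) * (1 - t * (1 - t) * c / (2 * m)) ^ n / t := by
  have hconj := flowHubList_apply_eq_conj κ φ (M := M) hμ t (fun k : Fin (K + 1) => if k = 0 then (1 : ℝ) else 0)
  have hpull := perfectTransport_pulledBack_eq φ (μ := μ) hperf
  have hP : (fun y z : Fin (K + 1) → S =>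
        t * ptGraphSwap μ (fun r : Fin m => ((0 : Fin (K + 1)), (κ r).succ)) (fun r => φ (κ r)) y z
          + (1 - t) * prodKernel (fun k : Fin (K + 1) => if k = 0 then (1 : ℝ) else 0) M y z)
      = fun a b => (fun y z : Fin (K + 1) → S =>
        t * ptGraphSwap (fun _ : Fin (K + 1) => μ 0) (fun r : Fin m => ((0 : Fin (K + 1)), (κ r).succ))
            (fun _ : Fin m => Equiv.refl S) y z
          + (1 - t) * prodKernel (fun k : Fin (K + 1) => if k = 0 then (1 : ℝ) else 0) (fun i u v => M i
              (((Fin.cons (Equiv.refl S) (fun k => (φ k).symm) : Fin (K + 1) → Equiv.Perm S) i).symm u)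
              (((Fin.cons (Equiv.refl S) (fun k => (φ k).symm) : Fin (K + 1) → Equiv.Perm S) i).symm v)) y z)
        (Equiv.piCongrRight (Fin.cons (Equiv.refl S) (fun k => (φ k).symm) : Fin (K + 1) → Equiv.Perm S) a)
        (Equiv.piCongrRight (Fin.cons (Equiv.refl S) (fun k => (φ k).symm) : Fin (K + 1) → Equiv.Perm S) b) := by
    funext a b
    rw [hconj a b, starRelabel_apply, starRelabel_apply, hpull]
  have hπ : tensorFun μ = fun a => tensorFun (fun _ : Fin (K + 1) => μ 0)
      (Equiv.piCongrRight (Fin.cons (Equiv.refl S) (fun k => (φ k).symm) : Fin (K + 1) → Equiv.Perm S) a) := by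
    funext a
    rw [tensorFun_starRelabel φ μ a, starRelabel_apply, hpull]
  rw [hP, hπ, sepDist_relabel (Equiv.piCongrRight (Fin.cons (Equiv.refl S) (fun k => (φ k).symm) :
      Fin (K + 1) → Equiv.Perm S))
    (fun y z : Fin (K + 1) → S =>
        t * ptGraphSwap (fun _ : Fin (K + 1) => μ 0) (fun r : Fin m => ((0 : Fin (K + 1)), (κ r).succ))
            (fun _ : Fin m => Equiv.refl S) y z
          + (1 - t) * prodKernel (fun k : Fin (K + 1) => if k = 0 then (1 : ℝ) else 0) (fun i u v => M i
              (((Fin.cons (Equiv.refl S) (fun k => (φ k).symm) : Fin (K + 1) → Equiv.Perm S) i).symm u)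
              (((Fin.cons (Equiv.refl S) (fun k => (φ k).symm) : Fin (K + 1) → Equiv.Perm S) i).symm v)) y z)
    (tensorFun (fun _ : Fin (K + 1) => μ 0)) n]
  exact idealStar_sepDist_le κ hm ht0 ht1 (fun v => hμ 0 v) hμ01 (relabel_kernels_isRowStochastic φ hM)
    (relabel_hotSampler φ hM0) hc1 hc hcm n

end Flow

/-! ## §3 The exact-refresh product chain -/

section Refresh
variable {d : ℕ} {μ : Fin d → S → ℝ} {M : Fin d → S → S → ℝ} {w : Fin d → ℝ}

/-- **`Pⁿ(x,z) ≥ (1 − Σ_k(1−w_k)ⁿ)·π̃(z)`** for the exact-refresh product chain. [ours] -/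
theorem refresh_kernelAt_ge (hμ : ∀ k v, 0 < μ k v) (hμ1 : ∀ k, ∑ v, μ k v = 1) (hM : ∀ k, IsRowStochastic (M k))
    (hMex : ∀ k u v, M k u v = μ k v) (hw0 : ∀ k, 0 ≤ w k) (hw1 : ∑ k, w k = 1) (n : ℕ) (x z : Fin d → S) :
    (1 - ∑ k : Fin d, (1 - w k) ^ n) * tensorFun μ z ≤ kernelAt (prodKernel w M) n x z := by
  set R : Finset (Fin d) → Finset (Fin d) → ℝ :=
    fun U V => ∑ k : Fin d, w k * (if V = U \ ({k} : Finset (Fin d)) then (1 : ℝ) else 0) with hR_def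
  have hR : ∀ U V, R U V = ∑ k : Fin d, w k * (if V = U \ ({k} : Finset (Fin d)) then (1 : ℝ) else 0) := fun U V => rfl
  have hcover := touch_lawAt_empty_ge (τ := fun k : Fin d => ({k} : Finset (Fin d))) hw0 hw1 hR univ n
  have hrate : ∑ k ∈ (univ : Finset (Fin d)), (1 - ∑ a ∈ univ.filter (fun a : Fin d => k ∈ ({a} : Finset (Fin d))), w a) ^ n
      = ∑ k : Fin d, (1 - w k) ^ n := sum_congr rfl fun k _ => by rw [singleSite_touchRate (w := w) k]
  rw [hrate] at hcover
  have hmin := refresh_minorization hμ hμ1 hM hMex hw0 hw1 hR x n z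
  have hπ0 : 0 ≤ tensorFun μ z := (tensorFun_pos hμ z).le
  unfold kernelAt
  exact (mul_le_mul_of_nonneg_right hcover hπ0).trans hmin

/-- **THE SEPARATION CEILING FOR EXACT REDRAWS: `s(n) ≤ Σ_k (1 − w_k)ⁿ`.** [ours] -/
theorem refresh_sepDist_le (hμ : ∀ k v, 0 < μ k v) (hμ1 : ∀ k, ∑ v, μ k v = 1) (hM : ∀ k, IsRowStochastic (M k))
    (hMex : ∀ k u v, M k u v = μ k v) (hw0 : ∀ k, 0 ≤ w k) (hw1 : ∑ k, w k = 1) (n : ℕ) :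
    sepDist (prodKernel w M) (tensorFun μ) n ≤ ∑ k : Fin d, (1 - w k) ^ n := by
  have hw1' : ∀ k, w k ≤ 1 := fun k => by rw [← hw1]; exact Finset.single_le_sum (fun j _ => hw0 j) (mem_univ _)
  have hbound : 0 ≤ ∑ k : Fin d, (1 - w k) ^ n := sum_nonneg fun k _ => pow_nonneg (by linarith [hw1' k]) n
  refine Real.iSup_le (fun x => Real.iSup_le (fun z => ?_) hbound) hbound
  have hπpos : 0 < tensorFun μ z := tensorFun_pos hμ z
  have h := refresh_kernelAt_ge hμ hμ1 hM hMex hw0 hw1 n x z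
  rw [sub_le_comm, le_div_iff₀ hπpos]
  linarith

end Refresh

end Summit.Ventures.LatticeQCDFlow.Scaling

end
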